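import Summits.KontsevichZagierPeriods.KontsevichZagierPeriods.Theorems.LinRedNormalFormArrangementNormalFormSeparateHighFanFree
import Summits.KontsevichZagierPeriods.KontsevichZagierPeriods.Theorems.LinRedNormalFormArrangementNormalFormSeparateHighNatural

/-!
# `stub_separateHigh` / `stub_separateThreeZero`: the fan corollaries in the stubs' indexing

(Line `janus-bands`, crux `ArrangementNormalForm`, stubs `stub_separateHigh` (base dimension
`b + 3`, `k` fibres, target `GG (b + 2) 1 k`) and `stub_separateThreeZero` (`JJ 3 0 → GG 2 1 0`);
part `Three` (registered as `separateHigh_fanFree_three`).)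

The parts `separateHigh_natural`, `separateHigh_fanPos`, `separateHigh_fanFree` are stated over
the base `ℝ^{B+2}` (every `B`). The registered stubs index the base as `b + 3` resp. `3`; the
identifications `b + 3 = (b + 1) + 2`, `3 + 0 = (1 + 2) + 0` are definitional but not syntactic,
so this file restates the three corollaries literally in the stubs' indexing (proofs: the
`B := b + 1` resp. `B := 1, k := 0` instances, accepted by definitional unfolding):

* `separateHigh_fanFree_three`, `separateHigh_fanPos_three` — literal `JJ (b+3) k` datum with
  numerator-free integrand integrable, resp. numerator bounded away from zero
  `⟹ ∃ c ∈ closure (GG (b+2) 1 k), [s] − c ∈ KZ.relations` (`GG` through `hGG`, as in the stub);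
* `separateHigh_natural_three` — literal `JJ (b+3) k` datum `⟹ closure (SeparatePos.GNset (b+2) k)`
  unconditionally;
* `separateThreeZero_fanFree` — literal `JJ 3 0` datum with numerator-free integrand integrable
  `⟹ closure (GG 2 1 0)`.

What is left of the two stubs after these parts is exactly the numerator split
`GG♮ (b+2) k → GG (b+2) 1 k` for data whose convergence is bought by the zeros of the numerator.
-/

noncomputable section

open Set MeasureTheory MvPolynomial

namespace Summit.KontsevichZagierPeriods.ArrangementNormalForm.JanusBands

open Literature.NumberTheory.Transcendental

open SeparatePos SepHigh in
/-- **`stub_separateHigh`, convergence not bought by the numerator, in the stub's indexing**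
(registered part `separateHigh_fanFree_three`; base dimension `b + 3`, `k` fibres): a literal
`JJ (b+3) k` datum whose numerator-free integrand is absolutely integrable on the domain is
congruent modulo `KZ.relations` to a `ℤ`-combination of elements of `GG (b+2) 1 k`.
[Kontsevich–Zagier 2001, §1.2] -/
theorem separateHigh_fanFree_three (GG : ℕ → ℕ → ℕ → Set KZ.FormalRep) (hGG : ∀ b σ k, GG b σ k = {w : KZ.FormalRep | ∃ (m m' n₁ n₂ : ℕ) (s : KZ.IntegralRep (b + 1 + k)) (M : Fin m' → (Fin (b + 1) → ℚ) × ℚ) (L : Fin m → (Fin b → ℚ) × ℚ) (e : Fin m → ℕ) (p : MvPolynomial (Fin b) ℚ) (ℓ₁ ℓ₂ : (Fin b → ℚ) × ℚ) (a : Fin k → Option ((Fin (b + 1) → ℚ) × ℚ)) (lo hi : Fin k → Fin k ⊕ ((Fin (b + 1) → ℚ) × ℚ)), (n₁ = 0 ∨ n₂ = 0) ∧ (σ = 2 → (∀ i c, a i = some c → c.1 (Fin.last b) = 0) ∧ (∀ i c, (lo i = Sum.inr c ∨ hi i = Sum.inr c) → (c.1 (Fin.last b) = 0 ∨ c = (Pi.single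 (Fin.last b) 1, 0)))) ∧ Bornology.IsBounded s.domain ∧ s.domain = {z | (∀ j, 0 < ∑ i, ((M j).1 i : ℝ) * z (Fin.castAdd k i) + ((M j).2 : ℝ)) ∧ ∀ i, Sum.elim (fun j => z (Fin.natAdd (b + 1) j)) (fun c => ∑ i', (c.1 i' : ℝ) * z (Fin.castAdd k i') + (c.2 : ℝ)) (lo i) < z (Fin.natAdd (b + 1) i) ∧ z (Fin.natAdd (b + 1) i) < Sum.elim (fun j => z (Fin.natAdd (b + 1) j)) (fun c => ∑ i', (c.1 i' : ℝ) * z (Fin.castAdd k i') + (c.2 : ℝ)) (hi i)} ∧ EqOn s.integrand (fun z => MvPolynomial.aeval (fun i => z (Fin.castAdd k (Fin.castSucc i))) p / (∏ j, (∑ i, ((L j).1 i : ℝ) * z (Fin.castAdd k (Fin.castSucc i)) + ((L j).2 : ℝ)) ^ e j) * ((z (Fin.castAdd k (Fin.last b)) - (∑ i, (ℓ₁.1 i : ℝ) * z (Fin.castAdd k (Fin.castSucc i)) + (ℓ₁.2 : ℝ))) ^ n₁ / (z (Fin.castAdd k (Fin.last b)) - (∑ i, (ℓ₂.1 i : ℝ)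 * z (Fin.castAdd k (Fin.castSucc i)) + (ℓ₂.2 : ℝ))) ^ n₂) * ∏ i, (a i).elim 1 (fun c => 1 / (z (Fin.natAdd (b + 1) i) - (∑ i', (c.1 i' : ℝ) * z (Fin.castAdd k i') + (c.2 : ℝ))))) s.domain ∧ w = KZ.of s}) (b k m m' : ℕ) (s : KZ.IntegralRep (b + 3 + k)) (M : Fin m' → (Fin (b + 3) → ℚ) × ℚ) (L : Fin m → (Fin (b + 3) → ℚ) × ℚ) (e : Fin m → ℕ) (p : MvPolynomial (Fin (b + 3)) ℚ) (a : Fin k → Option ((Fin (b + 3) → ℚ) × ℚ)) (lo hi : Fin k → Fin k ⊕ ((Fin (b + 3) → ℚ) × ℚ)) (hbd : Bornology.IsBounded s.domain) (hdom : s.domain = {z | (∀ j, 0 < ∑ i, ((M j).1 i : ℝ) * z (Fin.castAdd k i) + ((M j).2 : ℝ)) ∧ ∀ i, Sum.elim (fun j => z (Fin.natAdd (b + 3) j)) (fun c => ∑ i', (c.1 i' : ℝ) * z (Fin.castAdd k i') + (c.2 : ℝ)) (lo i) < z (Fin.natAdd (b + 3) i) ∧ z (Fin.natAdd (b + 3)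 i) < Sum.elim (fun j => z (Fin.natAdd (b + 3) j)) (fun c => ∑ i', (c.1 i' : ℝ) * z (Fin.castAdd k i') + (c.2 : ℝ)) (hi i)}) (hint : EqOn s.integrand (fun z => MvPolynomial.aeval (fun i => z (Fin.castAdd k i)) p / (∏ j, (∑ i, ((L j).1 i : ℝ) * z (Fin.castAdd k i) + ((L j).2 : ℝ)) ^ e j) * ∏ i, (a i).elim 1 (fun c => 1 / (z (Fin.natAdd (b + 3) i) - (∑ i', (c.1 i' : ℝ) * z (Fin.castAdd k i') + (c.2 : ℝ))))) s.domain) (hfree : IntegrableOn (fun z => (∏ j, (∑ i, ((L j).1 i : ℝ) * z (Fin.castAdd k i) + ((L j).2 : ℝ)) ^ e j)⁻¹ * ∏ i, (a i).elim 1 (fun c => 1 / (z (Fin.natAdd (b + 3) i) - (∑ i', (c.1 i' : ℝ) * z (Fin.castAdd k i') + (c.2 : ℝ))))) s.domain) : ∃ c ∈ AddSubgroup.closure (GG (b + 2) 1 k), KZ.of s - c ∈ KZ.relations :=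
  separateHigh_fanFree GG hGG (b + 1) k m m' s M L e p a lo hi hbd hdom hint hfree

open SeparatePos SepHigh in
/-- **`stub_separateHigh`, numerator bounded away from zero, in the stub's indexing** (base
dimension `b + 3`, `k` fibres): a literal `JJ (b+3) k` datum with `|P| ≥ c₀ > 0` on the domain
is congruent modulo `KZ.relations` to a `ℤ`-combination of elements of `GG (b+2) 1 k`.
[Kontsevich–Zagier 2001, §1.2] -/
theorem separateHigh_fanPos_three (GG : ℕ → ℕ → ℕ → Set KZ.FormalRep) (hGG : ∀ b σ k, GG b σ k = {w : KZ.FormalRep | ∃ (m m' n₁ n₂ : ℕ) (s : KZ.IntegralRep (b + 1 + k)) (M : Fin m' → (Fin (b + 1) → ℚ) × ℚ) (L : Fin m → (Fin b → ℚ) × ℚ) (e : Fin m → ℕ) (p : MvPolynomial (Fin b) ℚ) (ℓ₁ ℓ₂ : (Fin b → ℚ) × ℚ) (a : Fin k → Option ((Fin (b + 1) → ℚ) × ℚ)) (lo hi : Fin k → Fin k ⊕ ((Fin (b + 1) → ℚ) × ℚ)), (n₁ = 0 ∨ n₂ = 0) ∧ (σ = 2 → (∀ i c, a i = some c → c.1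 (Fin.last b) = 0) ∧ (∀ i c, (lo i = Sum.inr c ∨ hi i = Sum.inr c) → (c.1 (Fin.last b) = 0 ∨ c = (Pi.single (Fin.last b) 1, 0)))) ∧ Bornology.IsBounded s.domain ∧ s.domain = {z | (∀ j, 0 < ∑ i, ((M j).1 i : ℝ) * z (Fin.castAdd k i) + ((M j).2 : ℝ)) ∧ ∀ i, Sum.elim (fun j => z (Fin.natAdd (b + 1) j)) (fun c => ∑ i', (c.1 i' : ℝ) * z (Fin.castAdd k i') + (c.2 : ℝ)) (lo i) < z (Fin.natAdd (b + 1) i) ∧ z (Fin.natAdd (b + 1) i) < Sum.elim (fun j => z (Fin.natAdd (b + 1) j)) (fun c => ∑ i', (c.1 i' : ℝ) * z (Fin.castAdd k i') + (c.2 : ℝ)) (hi i)} ∧ EqOn s.integrand (fun z => MvPolynomial.aeval (fun i => z (Fin.castAdd k (Fin.castSucc i))) p / (∏ j, (∑ i, ((L j).1 i : ℝ) * z (Fin.castAdd k (Fin.castSucc i)) + ((L j).2 : ℝ)) ^ e j) * ((z (Fin.castAdd k (Fin.last b)) - (∑ i, (ℓ₁.1 i : ℝ) * z (Fin.castAdd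 k (Fin.castSucc i)) + (ℓ₁.2 : ℝ))) ^ n₁ / (z (Fin.castAdd k (Fin.last b)) - (∑ i, (ℓ₂.1 i : ℝ) * z (Fin.castAdd k (Fin.castSucc i)) + (ℓ₂.2 : ℝ))) ^ n₂) * ∏ i, (a i).elim 1 (fun c => 1 / (z (Fin.natAdd (b + 1) i) - (∑ i', (c.1 i' : ℝ) * z (Fin.castAdd k i') + (c.2 : ℝ))))) s.domain ∧ w = KZ.of s}) (b k m m' : ℕ) (s : KZ.IntegralRep (b + 3 + k)) (M : Fin m' → (Fin (b + 3) → ℚ) × ℚ) (L : Fin m → (Fin (b + 3) → ℚ) × ℚ) (e : Fin m → ℕ) (p : MvPolynomial (Fin (b + 3)) ℚ) (a : Fin k → Option ((Fin (b + 3) → ℚ) × ℚ)) (lo hi : Fin k → Fin k ⊕ ((Fin (b + 3) → ℚ) × ℚ)) (hbd : Bornology.IsBounded s.domain) (hdom : s.domain = {z | (∀ j, 0 < ∑ i, ((M j).1 i : ℝ) * z (Fin.castAdd k i) + ((M j).2 : ℝ)) ∧ ∀ i, Sum.elim (fun j => z (Fin.natAdd (b + 3) j)) (fun c => ∑ i',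 (c.1 i' : ℝ) * z (Fin.castAdd k i') + (c.2 : ℝ)) (lo i) < z (Fin.natAdd (b + 3) i) ∧ z (Fin.natAdd (b + 3) i) < Sum.elim (fun j => z (Fin.natAdd (b + 3) j)) (fun c => ∑ i', (c.1 i' : ℝ) * z (Fin.castAdd k i') + (c.2 : ℝ)) (hi i)}) (hint : EqOn s.integrand (fun z => MvPolynomial.aeval (fun i => z (Fin.castAdd k i)) p / (∏ j, (∑ i, ((L j).1 i : ℝ) * z (Fin.castAdd k i) + ((L j).2 : ℝ)) ^ e j) * ∏ i, (a i).elim 1 (fun c => 1 / (z (Fin.natAdd (b + 3) i) - (∑ i', (c.1 i' : ℝ) * z (Fin.castAdd k i') + (c.2 : ℝ))))) s.domain) (hnum : ∃ c₀ : ℝ, 0 < c₀ ∧ ∀ z ∈ s.domain, c₀ ≤ |MvPolynomial.aeval (fun i => z (Fin.castAdd k i)) p|) : ∃ c ∈ AddSubgroup.closure (GG (b + 2) 1 k), KZ.of s - c ∈ KZ.relations :=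
  separateHigh_fanPos GG hGG (b + 1) k m m' s M L e p a lo hi hbd hdom hint hnum

open SeparatePos SepHigh in
/-- **`JJ (b+3) k → closure GG♮ (b+2) k`, unconditionally, in the stub's indexing** (base
dimension `b + 3`, `k` fibres; target the literal intermediate class `SeparatePos.GNset (b+2) k`).
[Kontsevich–Zagier 2001, §1.2] -/
theorem separateHigh_natural_three (b k m m' : ℕ) (s : KZ.IntegralRep (b + 3 + k)) (M : Fin m' → (Fin (b + 3) → ℚ) × ℚ) (L : Fin m → (Fin (b + 3) → ℚ) × ℚ) (e : Fin m → ℕ) (p : MvPolynomial (Fin (b + 3)) ℚ) (a : Fin k → Option ((Fin (b + 3) → ℚ) × ℚ)) (lo hi : Fin k → Fin k ⊕ ((Fin (b + 3) → ℚ) × ℚ)) (hbd : Bornology.IsBounded s.domain) (hdom : s.domain = {z | (∀ j, 0 < ∑ i, ((M j).1 i : ℝ) * z (Fin.castAdd k i) + ((M j).2 : ℝ)) ∧ ∀ i, Sum.elim (fun j => z (Fin.natAdd (b + 3) j)) (fun c => ∑ i', (c.1 i' : ℝ) * z (Fin.castAdd k i') + (c.2 : ℝ)) (lo i) < z (Fin.natAdd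 (b + 3) i) ∧ z (Fin.natAdd (b + 3) i) < Sum.elim (fun j => z (Fin.natAdd (b + 3) j)) (fun c => ∑ i', (c.1 i' : ℝ) * z (Fin.castAdd k i') + (c.2 : ℝ)) (hi i)}) (hint : EqOn s.integrand (fun z => MvPolynomial.aeval (fun i => z (Fin.castAdd k i)) p / (∏ j, (∑ i, ((L j).1 i : ℝ) * z (Fin.castAdd k i) + ((L j).2 : ℝ)) ^ e j) * ∏ i, (a i).elim 1 (fun c => 1 / (z (Fin.natAdd (b + 3) i) - (∑ i', (c.1 i' : ℝ) * z (Fin.castAdd k i') + (c.2 : ℝ))))) s.domain) : ∃ c ∈ AddSubgroup.closure (SeparatePos.GNset (b + 2) k), KZ.of s - c ∈ KZ.relations :=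
  separateHigh_natural_GNset (b + 1) k m m' s M L e p a lo hi hbd hdom hint

open SeparatePos SepHigh in
/-- **`stub_separateThreeZero`, convergence not bought by the numerator** (`JJ 3 0 → GG 2 1 0`
for literal data whose numerator-free integrand is absolutely integrable; the text is the
`b := 3, k := 0` instance of the stub's `hJJ`). [Kontsevich–Zagier 2001, §1.2] -/
theorem separateThreeZero_fanFree (GG : ℕ → ℕ → ℕ → Set KZ.FormalRep) (hGG : ∀ b σ k, GG b σ k = {w : KZ.FormalRep | ∃ (m m' n₁ n₂ : ℕ) (s : KZ.IntegralRep (b + 1 + k)) (M : Fin m' → (Fin (b + 1) → ℚ) × ℚ) (L : Fin m → (Fin b → ℚ) × ℚ) (e : Fin m → ℕ) (p : MvPolynomial (Fin b) ℚ) (ℓ₁ ℓ₂ : (Fin b → ℚ) × ℚ) (a : Fin k → Option ((Fin (b + 1) → ℚ) × ℚ)) (lo hi : Fin k → Fin k ⊕ ((Fin (b + 1) → ℚ) × ℚ)), (n₁ = 0 ∨ n₂ = 0) ∧ (σ = 2 → (∀ i c, a i = some c → c.1 (Fin.last b) = 0) ∧ (∀ i c, (lo i = Sum.inr c ∨ hi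 i = Sum.inr c) → (c.1 (Fin.last b) = 0 ∨ c = (Pi.single (Fin.last b) 1, 0)))) ∧ Bornology.IsBounded s.domain ∧ s.domain = {z | (∀ j, 0 < ∑ i, ((M j).1 i : ℝ) * z (Fin.castAdd k i) + ((M j).2 : ℝ)) ∧ ∀ i, Sum.elim (fun j => z (Fin.natAdd (b + 1) j)) (fun c => ∑ i', (c.1 i' : ℝ) * z (Fin.castAdd k i') + (c.2 : ℝ)) (lo i) < z (Fin.natAdd (b + 1) i) ∧ z (Fin.natAdd (b + 1) i) < Sum.elim (fun j => z (Fin.natAdd (b + 1) j)) (fun c => ∑ i', (c.1 i' : ℝ) * z (Fin.castAdd k i') + (c.2 : ℝ)) (hi i)} ∧ EqOn s.integrand (fun z => MvPolynomial.aeval (fun i => z (Fin.castAdd k (Fin.castSucc i))) p / (∏ j, (∑ i, ((L j).1 i : ℝ) * z (Fin.castAdd k (Fin.castSucc i)) + ((L j).2 : ℝ)) ^ e j) * ((z (Fin.castAdd k (Fin.last b)) - (∑ i, (ℓ₁.1 i : ℝ) * z (Fin.castAdd k (Fin.castSucc i)) + (ℓ₁.2 : ℝ))) ^ n₁ / (z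 (Fin.castAdd k (Fin.last b)) - (∑ i, (ℓ₂.1 i : ℝ) * z (Fin.castAdd k (Fin.castSucc i)) + (ℓ₂.2 : ℝ))) ^ n₂) * ∏ i, (a i).elim 1 (fun c => 1 / (z (Fin.natAdd (b + 1) i) - (∑ i', (c.1 i' : ℝ) * z (Fin.castAdd k i') + (c.2 : ℝ))))) s.domain ∧ w = KZ.of s}) (m m' : ℕ) (s : KZ.IntegralRep (3 + 0)) (M : Fin m' → (Fin 3 → ℚ) × ℚ) (L : Fin m → (Fin 3 → ℚ) × ℚ) (e : Fin m → ℕ) (p : MvPolynomial (Fin 3) ℚ) (a : Fin 0 → Option ((Fin 3 → ℚ) × ℚ)) (lo hi : Fin 0 → Fin 0 ⊕ ((Fin 3 → ℚ) × ℚ)) (hbd : Bornology.IsBounded s.domain) (hdom : s.domain = {z | (∀ j, 0 < ∑ i, ((M j).1 i : ℝ) * z (Fin.castAdd 0 i) + ((M j).2 : ℝ)) ∧ ∀ i, Sum.elim (fun j => z (Fin.natAdd 3 j)) (fun c => ∑ i', (c.1 i' : ℝ) * z (Fin.castAdd 0 i') + (c.2 : ℝ)) (lo i) < z (Fin.natAdd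 3 i) ∧ z (Fin.natAdd 3 i) < Sum.elim (fun j => z (Fin.natAdd 3 j)) (fun c => ∑ i', (c.1 i' : ℝ) * z (Fin.castAdd 0 i') + (c.2 : ℝ)) (hi i)}) (hint : EqOn s.integrand (fun z => MvPolynomial.aeval (fun i => z (Fin.castAdd 0 i)) p / (∏ j, (∑ i, ((L j).1 i : ℝ) * z (Fin.castAdd 0 i) + ((L j).2 : ℝ)) ^ e j) * ∏ i, (a i).elim 1 (fun c => 1 / (z (Fin.natAdd 3 i) - (∑ i', (c.1 i' : ℝ) * z (Fin.castAdd 0 i') + (c.2 : ℝ))))) s.domain) (hfree : IntegrableOn (fun z => (∏ j, (∑ i, ((L j).1 i : ℝ) * z (Fin.castAdd 0 i) + ((L j).2 : ℝ)) ^ e j)⁻¹ * ∏ i, (a i).elim 1 (fun c => 1 / (z (Fin.natAdd 3 i) - (∑ i', (c.1 i' : ℝ) * z (Fin.castAdd 0 i') + (c.2 : ℝ))))) s.domain) : ∃ c ∈ AddSubgroup.closure (GG 2 1 0), KZ.of s - c ∈ KZ.relations :=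
  separateHigh_fanFree GG hGG 1 0 m m' s M L e p a lo hi hbd hdom hint hfree

end Summit.KontsevichZagierPeriods.ArrangementNormalForm.JanusBands
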